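import Literature.Claims.NS.Stanley2025
import Literature.Analysis.FluidPDE.TorusClassicalNSGalileanBoost
import Literature.Analysis.FunctionSpaces.TorusSupNormContinuity
import Literature.Analysis.FunctionSpaces.TorusSpaceTime
import HarnessLib

/-!
# Solo salvage for claim C85 `Stanley2025` (cell `ns-claims`, D-0090): Step 5 holds — the
# Lipschitz-integrability bound of Proposition 2 does give global regularity on `𝕋³`

Claim skeleton: `Literature/Claims/NS/Stanley2025.lean` (typist `ns-claims-typist-7` g2; D. Stanley, OSF
Preprints 8hv92 v1 (2025)). This file (seat `ns-claims-salvage-p3`) proves in the kernel the one step of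
the architecture that is TRUE as typed:

* `stanley2025_step_T3reg_holds : Step_T3reg`, i.e. `PropTwoBound → T3GlobalRegularity` — Theorem 5 (BKM)
  p.21 with items 24–32: IF every classical solution on `𝕋³ × [0,T]` obeyed
  `∫₀ᵀ ‖∇u‖²_{L^∞} ≤ C(ν,η)(T + ‖∇u₀‖²₂ + S_η(u₀))`, THEN every smooth divergence-free datum on `𝕋³` (of
  any mean) would have a global classical solution. Proof (Beale–Kato–Majda / `∇u ∈ L¹_t L^∞_x`
  continuation): take the maximal classical solution through `u₀`
  (`Torus.exists_maximal_classicalNS_anyMean`); on a finite maximal window `[0,T*)` the hypothesis bounds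
  `∫₀ᵗ M²` for the continuous majorant `M(t) = Σᵢ ‖∂ᵢu(t)‖_∞` uniformly in `t < T*`
  (`M² ≤ 9‖∇u‖²_{L^∞}`), hence `∫₀ᵗ M ≤ T* + ∫₀ᵗ M²` is bounded, and
  `Torus.classicalNS_continuation_of_gradientSup_integral_le_anyMean` continues the solution past `T*`,
  contradicting maximality.

The antecedent `PropTwoBound` is the refuter's business (its printed proof rests on Lemma 14 p.26); this
file says nothing about it. Solo lane (`Theorems/SoloSalvage<Slug>.lean`, no item).

WHAT THIS IS NOT: not a claim about NS regularity or blow-up; not a claim about any author beyond the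
typed locator.
-/

noncomputable section

-- The summit-side namespace repeats the summit name by design (D-0017 layout); tree precedent
-- `SoloSalvageLam2019.lean`.
set_option linter.dupNamespace false

open MeasureTheory Set Filter Topology
open scoped ENNReal

namespace Summit.NavierStokesRegularity.NavierStokesRegularity.Theorems.Stanley2025Salvage

open Literature.Analysis.FunctionSpaces Literature.Analysis.FluidPDE Literature.Claims.NS.Stanley2025

/-- `‖∂ᵢ v(x)‖ₑ ≤ ‖∇v(x)‖ₑ` (operator norm) for a smooth field on the torus. -/
theorem enorm_partialDeriv_le_enorm_fderiv {v : T3 → E3} (hv : Torus.IsSmooth v) (i : Fin 3) (x : T3) :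
    ‖Torus.partialDeriv i v x‖ₑ ≤ ‖Torus.fderiv v x‖ₑ := by
  rw [← ofReal_norm, ← ofReal_norm]
  apply ENNReal.ofReal_le_ofReal
  rw [Torus.partialDeriv_eq_fderiv_apply (hv.isContDiff (mod_cast le_top)) i x]
  refine (ContinuousLinearMap.le_opNorm _ _).trans ?_
  rw [EuclideanSpace.single, PiLp.norm_single, norm_one, mul_one]

/-- The continuous majorant `M = Σᵢ ‖∂ᵢv‖_∞` is dominated by `3‖∇v‖_{L^∞}`:
`ofReal (Σᵢ ‖∂ᵢv‖_∞)² ≤ 9 · eLipSq v`. -/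
theorem ofReal_sum_eSupNorm_sq_le {v : T3 → E3} (hv : Torus.IsSmooth v) :
    ENNReal.ofReal ((∑ i : Fin 3, (eSupNorm (Torus.partialDeriv i v)).toReal) ^ 2) ≤ 9 * eLipSq v := by
  set L : ℝ≥0∞ := ⨆ x, ‖Torus.fderiv v x‖ₑ with hL
  have hi : ∀ i : Fin 3, ENNReal.ofReal ((eSupNorm (Torus.partialDeriv i v)).toReal) ≤ L := by
    intro i
    rw [ENNReal.ofReal_toReal (Torus.eSupNorm_lt_top_of_continuous (hv.partialDeriv i).continuous).ne]
    exact iSup_le fun x => (enorm_partialDeriv_le_enorm_fderiv hv i x).trans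
      (le_iSup (fun y => ‖Torus.fderiv v y‖ₑ) x)
  have hnn : ∀ i : Fin 3, 0 ≤ (eSupNorm (Torus.partialDeriv i v)).toReal := fun i => ENNReal.toReal_nonneg
  have hsum : ENNReal.ofReal (∑ i : Fin 3, (eSupNorm (Torus.partialDeriv i v)).toReal) ≤ 3 * L := by
    rw [ENNReal.ofReal_sum_of_nonneg (fun i _ => hnn i)]
    calc ∑ i : Fin 3, ENNReal.ofReal ((eSupNorm (Torus.partialDeriv i v)).toReal)
        ≤ ∑ _i : Fin 3, L := Finset.sum_le_sum fun i _ => hi i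
      _ = 3 * L := by simp
  rw [ENNReal.ofReal_pow (Finset.sum_nonneg fun i _ => hnn i)]
  calc ENNReal.ofReal (∑ i : Fin 3, (eSupNorm (Torus.partialDeriv i v)).toReal) ^ 2
      ≤ (3 * L) ^ 2 := pow_le_pow_left' hsum 2
    _ = 9 * L ^ 2 := by ring
    _ = 9 * eLipSq v := by rw [hL]; rfl

/-- **Step 5 — `Step_T3reg` holds**: the bound of Proposition 2 (as typed, `PropTwoBound`) implies global
regularity on `𝕋³` for smooth divergence-free data of arbitrary mean (`T3GlobalRegularity`), by the
maximal-solution dichotomy and the `∇u ∈ L¹_t L^∞_x` continuation criterion (Beale–Kato–Majda 1984;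
Robinson–Rodrigo–Sadowski 2016 Thm 12.3), both in their any-mean forms. -/
theorem stanley2025_step_T3reg_holds : Literature.Claims.NS.Stanley2025.Step_T3reg := by
  intro hP2 ν hν u₀ hu₀ hdiv
  have hd : Fintype.card (Fin 3) = 3 := Fintype.card_fin 3
  obtain ⟨C, hC, hB⟩ := hP2 ν 1 hν one_pos
  obtain ⟨U, P, hU0, hcases⟩ := Torus.exists_maximal_classicalNS_anyMean hd hν hu₀ hdiv
  rcases hcases with ⟨hglob, -⟩ | ⟨T, hT, hsol, -, hmax⟩
  · exact ⟨U, P, hglob, hU0⟩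
  exfalso
  -- the continuous majorant `M(t) = Σᵢ ‖∂ᵢU(t)‖_∞`
  set M : ℝ → ℝ := fun t => ∑ i : Fin 3, (eSupNorm (Torus.partialDeriv i (U t))).toReal with hM
  have hMc : ContinuousOn M (Ico 0 T) :=
    continuousOn_finsetSum _ fun i _ =>
      (hsol.smooth_velocity.partialDeriv (uniqueDiffOn_Ico 0 T) i).continuousOn_toReal_eSupNorm
  have hM0 : ∀ t ∈ Ico 0 T, 0 ≤ M t := fun t _ =>
    Finset.sum_nonneg fun i _ => ENNReal.toReal_nonneg
  have hM0' : ∀ t, 0 ≤ M t := fun t => Finset.sum_nonneg fun i _ => ENNReal.toReal_nonneg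
  have hMdom : ∀ t ∈ Ico 0 T, ∀ x, ∑ i, ‖Torus.partialDeriv i (U t) x‖ ^ 2 ≤ M t ^ 2 := by
    intro t ht x
    have hsm : Torus.IsSmooth (U t) := hsol.smooth_velocity.isSmooth_slice ht
    have hle : ∀ i : Fin 3, ‖Torus.partialDeriv i (U t) x‖ ≤
        (eSupNorm (Torus.partialDeriv i (U t))).toReal := fun i =>
      Torus.norm_le_toReal_eSupNorm (hsm.partialDeriv i).continuous x
    calc ∑ i, ‖Torus.partialDeriv i (U t) x‖ ^ 2
        ≤ ∑ i : Fin 3, (eSupNorm (Torus.partialDeriv i (U t))).toReal ^ 2 :=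
          Finset.sum_le_sum fun i _ => pow_le_pow_left₀ (norm_nonneg _) (hle i) 2
      _ ≤ M t ^ 2 := Finset.sum_sq_le_sq_sum_of_nonneg fun i _ => ENNReal.toReal_nonneg
  -- the uniform bound on `∫₀ᵗ M²` from `PropTwoBound` on the windows `[0,t]`, `t < T`
  set B : ℝ := max (C * (T + Xgrad (U 0) + entropyS 1 (U 0))) 0 with hBdef
  have hB0 : 0 ≤ B := le_max_right _ _
  have hM2 : ∀ t ∈ Ico 0 T, 0 < t → ∫ s in (0 : ℝ)..t, M s ^ 2 ≤ 9 * B := by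
    intro t ht ht0
    have hsol_t : Torus.IsClassicalNSSolutionOn (Icc 0 t) ν 0 U P :=
      hsol.mono (Icc_subset_Ico_right ht.2) (uniqueDiffOn_Icc ht0)
    have h1 := hB t U P ht0 hsol_t
    -- pointwise domination inside the window
    have hpt : ∀ s ∈ Ioo 0 t, ENNReal.ofReal (M s ^ 2) ≤ 9 * eLipSq (U s) := fun s hs =>
      ofReal_sum_eSupNorm_sq_le (hsol.smooth_velocity.isSmooth_slice ⟨hs.1.le, hs.2.trans ht.2⟩)
    have h2 : ∫⁻ s in Ioo 0 t, ENNReal.ofReal (M s ^ 2) ≤ ENNReal.ofReal (9 * B) := by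
      calc ∫⁻ s in Ioo 0 t, ENNReal.ofReal (M s ^ 2)
          ≤ ∫⁻ s in Ioo 0 t, 9 * eLipSq (U s) := setLIntegral_mono' measurableSet_Ioo hpt
        _ = 9 * ∫⁻ s in Ioo 0 t, eLipSq (U s) := lintegral_const_mul' 9 _ (by norm_num)
        _ ≤ 9 * ENNReal.ofReal (C * (t + Xgrad (U 0) + entropyS 1 (U 0))) := by gcongr
        _ ≤ 9 * ENNReal.ofReal B := by
            gcongr
            refine le_trans ?_ (le_max_left _ _)
            have : t ≤ T := ht.2.le
            nlinarith
        _ = ENNReal.ofReal (9 * B) := by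
            rw [ENNReal.ofReal_mul (by norm_num : (0 : ℝ) ≤ 9)]
            norm_num
    -- convert to the real interval integral
    have hcont : ContinuousOn (fun s => M s ^ 2) (Icc 0 t) :=
      (hMc.mono (Icc_subset_Ico_right ht.2)).pow 2
    rw [intervalIntegral.integral_of_le ht0.le,
      integral_eq_lintegral_of_nonneg_ae (Eventually.of_forall fun s => sq_nonneg (M s))
        ((hcont.mono Ioc_subset_Icc_self).aestronglyMeasurable measurableSet_Ioc)]
    refine ENNReal.toReal_le_of_le_ofReal (by positivity) ?_
    rw [setLIntegral_congr Ioo_ae_eq_Ioc.symm]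
    exact h2
  -- hence `∫₀ᵗ M ≤ T + 9B` on `[0,T)`
  have hI : ∀ t ∈ Ico 0 T, ∫ s in (0 : ℝ)..t, M s ≤ T + 9 * B := by
    intro t ht
    rcases ht.1.eq_or_lt with h0 | ht0
    · rw [← h0, intervalIntegral.integral_same]
      positivity
    have hcI : ContinuousOn M (Icc 0 t) := hMc.mono (Icc_subset_Ico_right ht.2)
    have hiM : IntervalIntegrable M volume 0 t :=
      (hcI.mono (by rw [uIcc_of_le ht0.le])).intervalIntegrable
    have hiM2 : IntervalIntegrable (fun s => M s ^ 2) volume 0 t :=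
      ((hcI.pow 2).mono (by rw [uIcc_of_le ht0.le])).intervalIntegrable
    have hi1 : IntervalIntegrable (fun _ : ℝ => (1 : ℝ)) volume 0 t := intervalIntegrable_const
    calc ∫ s in (0 : ℝ)..t, M s ≤ ∫ s in (0 : ℝ)..t, (1 + M s ^ 2) := by
          refine intervalIntegral.integral_mono_on ht0.le hiM (hi1.add hiM2) fun s _ => ?_
          nlinarith [sq_nonneg (M s - 1)]
      _ = t + ∫ s in (0 : ℝ)..t, M s ^ 2 := by
          rw [intervalIntegral.integral_add hi1 hiM2, intervalIntegral.integral_const, smul_eq_mul,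
            mul_one, sub_zero]
      _ ≤ T + 9 * B := add_le_add ht.2.le (hM2 t ht ht0)
  -- continuation past `T`, contradicting maximality
  obtain ⟨T', hTT', u', p', hu', hagree⟩ :=
    Torus.classicalNS_continuation_of_gradientSup_integral_le_anyMean hd hν hT hsol hMc hM0 hMdom hI
  have hu'0 : u' 0 = u₀ := by rw [hagree 0 ⟨le_rfl, hT⟩, hU0]
  exact (lt_irrefl T) (hTT'.trans (hmax T' u' p' hu' hu'0).1)

end Summit.NavierStokesRegularity.NavierStokesRegularity.Theorems.Stanley2025Salvage

end
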